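import Summits.QuantumFields.YangMills.Theorems.PoincareLipschitzZeroDensityOfTangentMaps
import HarnessLib

/-!
# Crux `BlockLipschitzL` (stmt-QuantumFields-23533) ∕ `HistoryTailL` (stmt-QuantumFields-19936), LINE 25 «CompactnessTransfer»,
# stub S1″ — the (TM) road, file TM-G1 «THE BLOW-UP AT THE CENTRE, EXPORTED»

Cell `ym3-torus` (YM ladder rung R3 = continuum SU(2) Yang–Mills on T³ — a RUNG, NOT Clay: not d = 4, not infinite volume,
not a mass gap); WIDTH helper seat `ym3-torus-px3` g9 (LEAD ★w1-19936 g10 «GO (i)» 15:27:31Z); `--supports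
stmt-QuantumFields-23533`; THEOREMS ONLY (0 `def`, 0 `sorry`, default heartbeats); imports TM-D ✓`…ZeroDensityOfTangentMaps`.
THIS FILE = §1 (the blow-up, exported); §2–§3 (the density cap for the class and the gap knit) are file TM-G2
✓`…CentralDensityCapOfClass` (imports TM-F2b ★★★`slope_le_three_pi` and w7 g14's ✓`…MinimiserStability`).

WHAT THIS FILE DOES (the vended class: finite-energy unit `W^{1,2}` maps `U : Q → S³ ⊂ ℝ⁴` minimising on balls [Simon1996 §2.1]):
* ★★ `exists_blowup_linear (hMono) (hCpt)` — THE BLOW-UP (TM-D's first half, exported): for every class member `U` there are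
  `Θ ≥ 0` — the central density `inf_{0<r≤½} r⁻¹E(U;B_r(0)) = lim_{r↓0}` — and a class member `φ` with LINEAR central
  energies `E(φ; B_r(0)) = Θ·r` (`0 < r ≤ ½`).
* ★★★ `centralDensity_le_three_pi (hCpt) : ⟨for every class member, ∀ η > 0 ∃ ρ ∈ (0,1), ρ⁻¹E(U;B_ρ(0)) ≤ 3π + η⟩` —
  **EVERY MINIMISER HAS CENTRAL DENSITY `≤ 3π`; EQUIVALENTLY EVERY MINIMIZING TANGENT MAP `ℝ³ → S³` HAS `Θ = E_{S²}(ω) ≤ 3π`**,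
  BY KERNEL modulo (C) only: blow-up + w7's stability theorem + TM-F2b's cap.  [SchoenUhlenbeck1984, proof of Prop. 1.2: stability
  (1.3)–(1.5) with radial test functions and the Hardy constant `¼`].
* ★★★ `zeroDensity_of_compactness_gap (hCpt) (hGap) : ⟨(ZD)⟩` and ★★★ `uniformSmallScaleEnergy_band_of_compactness_gap (hCpt) (hGap) :
  ⟨registered stub_uniformSmallScaleEnergy text VERBATIM⟩` — S1″ ⟸ (C) ∧ (GAP) with **(GAP)** «a class member whose central ball
  energies are LINEAR with slope `Θ ≤ 3π` has `Θ = 0`» — the `8π` ENERGY GAP for minimizing tangent maps `ℝ³ → S³`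
  [SchoenUhlenbeck1984, Lemma 1.1 («if `u : S² → S³` is a non-constant harmonic map, `E(u)` is an integral multiple of `8π`») read
  through the homogeneity of tangent maps and the regularity of their links]; (GAP) is implied by (TM) [Prop. 1.2] and is what is
  LEFT of it after the kernel's `Θ ≤ 3π`.  Its printed proofs use Hélein's regularity of weakly harmonic 2-spheres (or
  [SchoenUhlenbeck1982] away from the origin) — NOT proved here; (GAP) is a NAMED PRINTED FACT as a binder text.
HONEST SCOPE.  (C) and (GAP) are HYPOTHESES; (ZD), S1″ NOT proved unconditionally; (TM) NOT proved; K1, `MeanDeviationL`,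
`BlockLipschitzL`, `HistoryTailL` NOT proved.  YM₃ on T³ is rung R3, not Clay; YM gap NOT proved; no summit statement is proved here.

References: R. Schoen, K. Uhlenbeck, Invent. Math. 78 (1984) 89–100 [SchoenUhlenbeck1984] (Lemma 1.1 p. 90, Prop. 1.2 p. 90,
(1.3)–(1.5), Lemma 1.3 p. 91); L. Simon (1996) [Simon1996] (§2.4, §2.9 Lemma 1, §3.1–3.2); [Luckhaus1988]; [SchoenUhlenbeck1982] §2.
-/

set_option autoImplicit false

noncomputable section

open scoped BigOperators Topology ContDiff
open MeasureTheory Set Filter Metric Function TopologicalSpace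

namespace Summit.QuantumFields.YangMills.Theorems.PoincareLipschitzCentralDensityCap

open Literature.Analysis.FunctionSpaces (HasWeakFDerivOn)
open Summit.QuantumFields.YangMills.Theorems.PoincareLipschitzMinimiserBallBridge (absCube_subset_ball closedBall_subset_unitCube)
open Summit.QuantumFields.YangMills.Theorems.PoincareLipschitzMinimiserMonotonicity (hMono_holds)
open Summit.QuantumFields.YangMills.Theorems.PoincareLipschitzMinimiserDilationLetters (setIntegral_dens_dilate_ball smul_mem_unitCube)
open Summit.QuantumFields.YangMills.Theorems.PoincareLipschitzMinimiserDilation (sMin_dilate setIntegral_dens_dilate_unitCube)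
open Summit.QuantumFields.YangMills.Theorems.PoincareLipschitzUniformSmallScaleEnergyOfZeroDensity
  (uniformSmallScaleEnergy_band_of_zeroDensity)

/-! ## §1 The blow-up at the centre, exported -/

-- hb: measured 2026-08-29 px3 g9 — the blow-up bookkeeping in one declaration passes the farm default (200k) but not 100k
-- (TM-D class); decl-local budget per README «HEARTBEAT BUDGET» ∕ №24 (a), statement untouched.
set_option maxHeartbeats 400000 in
/-- ★★ **THE BLOW-UP AT THE CENTRE.**  For every map `U` of the vended class: the central density `Θ := inf_{0<r≤½} r⁻¹E(U;B_r(0))`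
(`≥ 0`, approached from above as `r ↓ 0` by (M)) is the slope of the LINEAR central ball energies `E(φ;B_r(0)) = Θ·r` (`0 < r ≤ ½`)
of some class member `φ` — the (C)-limit of the dilations `U ∘ (4⁻¹2⁻ʲ•)` (TM-B2 ★★★`sMin_dilate`). [cite: Simon1996, §3.1 and §2.9 Lemma 1; SchoenUhlenbeck1982, §2] -/
theorem exists_blowup_linear
    (hMono : ∀ (hQ : IsOpen {x : EuclideanSpace ℝ (Fin 3) | ∀ i : Fin 3, |x i| < 1}) (U : EuclideanSpace ℝ (Fin 3) → EuclideanSpace ℝ (Fin 4)) (G : EuclideanSpace ℝ (Fin 3) → (EuclideanSpace ℝ (Fin 3) →L[ℝ] EuclideanSpace ℝ (Fin 4))),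
      (HasWeakFDerivOn ⟨{x : EuclideanSpace ℝ (Fin 3) | ∀ i : Fin 3, |x i| < 1}, hQ⟩ volume U G ∧
        (∀ x : EuclideanSpace ℝ (Fin 3), (∀ i : Fin 3, |x i| < 1) → ‖U x‖ = 1) ∧
        IntegrableOn (fun x => ∑ i : Fin 3, ‖G x (EuclideanSpace.single i (1:ℝ))‖ ^ 2) {x : EuclideanSpace ℝ (Fin 3) | ∀ i : Fin 3, |x i| < 1} ∧
        (∀ (y : EuclideanSpace ℝ (Fin 3)) (ρ : ℝ), 0 < ρ → closedBall y ρ ⊆ {x : EuclideanSpace ℝ (Fin 3) | ∀ i : Fin 3, |x i| < 1} →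
          ∀ (W : EuclideanSpace ℝ (Fin 3) → EuclideanSpace ℝ (Fin 4)) (GW : EuclideanSpace ℝ (Fin 3) → (EuclideanSpace ℝ (Fin 3) →L[ℝ] EuclideanSpace ℝ (Fin 4))),
          HasWeakFDerivOn ⟨{x : EuclideanSpace ℝ (Fin 3) | ∀ i : Fin 3, |x i| < 1}, hQ⟩ volume W GW →
          (∀ x : EuclideanSpace ℝ (Fin 3), (∀ i : Fin 3, |x i| < 1) → ‖W x‖ = 1) →
          IntegrableOn (fun x => ∑ i : Fin 3, ‖GW x (EuclideanSpace.single i (1:ℝ))‖ ^ 2) {x : EuclideanSpace ℝ (Fin 3) | ∀ i : Fin 3, |x i| < 1} →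
          (∃ ρ' : ℝ, ρ' < ρ ∧ ∀ x : EuclideanSpace ℝ (Fin 3), x ∉ ball y ρ' → W x = U x) →
          ∫ x in ball y ρ, ∑ i : Fin 3, ‖G x (EuclideanSpace.single i (1:ℝ))‖ ^ 2 ≤ ∫ x in ball y ρ, ∑ i : Fin 3, ‖GW x (EuclideanSpace.single i (1:ℝ))‖ ^ 2)) →
      ∀ (y : EuclideanSpace ℝ (Fin 3)) (σ ρ : ℝ), 0 < σ → σ ≤ ρ → closedBall y ρ ⊆ {x : EuclideanSpace ℝ (Fin 3) | ∀ i : Fin 3, |x i| < 1} →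
        σ⁻¹ * ∫ x in ball y σ, ∑ i : Fin 3, ‖G x (EuclideanSpace.single i (1:ℝ))‖ ^ 2 ≤ ρ⁻¹ * ∫ x in ball y ρ, ∑ i : Fin 3, ‖G x (EuclideanSpace.single i (1:ℝ))‖ ^ 2)
    (hCpt : ∀ (hQ : IsOpen {x : EuclideanSpace ℝ (Fin 3) | ∀ i : Fin 3, |x i| < 1}) (Λ : ℝ) (u : ℕ → EuclideanSpace ℝ (Fin 3) → EuclideanSpace ℝ (Fin 4)) (Gs : ℕ → EuclideanSpace ℝ (Fin 3) → (EuclideanSpace ℝ (Fin 3) →L[ℝ] EuclideanSpace ℝ (Fin 4))),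
      (∀ j : ℕ, (HasWeakFDerivOn ⟨{x : EuclideanSpace ℝ (Fin 3) | ∀ i : Fin 3, |x i| < 1}, hQ⟩ volume (u j) (Gs j) ∧
        (∀ x : EuclideanSpace ℝ (Fin 3), (∀ i : Fin 3, |x i| < 1) → ‖(u j) x‖ = 1) ∧
        IntegrableOn (fun x => ∑ i : Fin 3, ‖(Gs j) x (EuclideanSpace.single i (1:ℝ))‖ ^ 2) {x : EuclideanSpace ℝ (Fin 3) | ∀ i : Fin 3, |x i| < 1} ∧
        (∀ (y : EuclideanSpace ℝ (Fin 3)) (ρ : ℝ), 0 < ρ → closedBall y ρ ⊆ {x : EuclideanSpace ℝ (Fin 3) | ∀ i : Fin 3, |x i| < 1} →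
          ∀ (W : EuclideanSpace ℝ (Fin 3) → EuclideanSpace ℝ (Fin 4)) (GW : EuclideanSpace ℝ (Fin 3) → (EuclideanSpace ℝ (Fin 3) →L[ℝ] EuclideanSpace ℝ (Fin 4))),
          HasWeakFDerivOn ⟨{x : EuclideanSpace ℝ (Fin 3) | ∀ i : Fin 3, |x i| < 1}, hQ⟩ volume W GW →
          (∀ x : EuclideanSpace ℝ (Fin 3), (∀ i : Fin 3, |x i| < 1) → ‖W x‖ = 1) →
          IntegrableOn (fun x => ∑ i : Fin 3, ‖GW x (EuclideanSpace.single i (1:ℝ))‖ ^ 2) {x : EuclideanSpace ℝ (Fin 3) | ∀ i : Fin 3, |x i| < 1} →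
          (∃ ρ' : ℝ, ρ' < ρ ∧ ∀ x : EuclideanSpace ℝ (Fin 3), x ∉ ball y ρ' → W x = (u j) x) →
          ∫ x in ball y ρ, ∑ i : Fin 3, ‖(Gs j) x (EuclideanSpace.single i (1:ℝ))‖ ^ 2 ≤ ∫ x in ball y ρ, ∑ i : Fin 3, ‖GW x (EuclideanSpace.single i (1:ℝ))‖ ^ 2))) →
      (∀ j : ℕ, ∫ x in {x : EuclideanSpace ℝ (Fin 3) | ∀ i : Fin 3, |x i| < 1}, ∑ i : Fin 3, ‖(Gs j) x (EuclideanSpace.single i (1:ℝ))‖ ^ 2 ≤ Λ) →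
      ∃ (U : EuclideanSpace ℝ (Fin 3) → EuclideanSpace ℝ (Fin 4)) (G : EuclideanSpace ℝ (Fin 3) → (EuclideanSpace ℝ (Fin 3) →L[ℝ] EuclideanSpace ℝ (Fin 4))) (φ : ℕ → ℕ), StrictMono φ ∧
        (HasWeakFDerivOn ⟨{x : EuclideanSpace ℝ (Fin 3) | ∀ i : Fin 3, |x i| < 1}, hQ⟩ volume U G ∧
          (∀ x : EuclideanSpace ℝ (Fin 3), (∀ i : Fin 3, |x i| < 1) → ‖U x‖ = 1) ∧
          IntegrableOn (fun x => ∑ i : Fin 3, ‖G x (EuclideanSpace.single i (1:ℝ))‖ ^ 2) {x : EuclideanSpace ℝ (Fin 3) | ∀ i : Fin 3, |x i| < 1} ∧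
          (∀ (y : EuclideanSpace ℝ (Fin 3)) (ρ : ℝ), 0 < ρ → closedBall y ρ ⊆ {x : EuclideanSpace ℝ (Fin 3) | ∀ i : Fin 3, |x i| < 1} →
            ∀ (W : EuclideanSpace ℝ (Fin 3) → EuclideanSpace ℝ (Fin 4)) (GW : EuclideanSpace ℝ (Fin 3) → (EuclideanSpace ℝ (Fin 3) →L[ℝ] EuclideanSpace ℝ (Fin 4))),
            HasWeakFDerivOn ⟨{x : EuclideanSpace ℝ (Fin 3) | ∀ i : Fin 3, |x i| < 1}, hQ⟩ volume W GW →
            (∀ x : EuclideanSpace ℝ (Fin 3), (∀ i : Fin 3, |x i| < 1) → ‖W x‖ = 1) →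
            IntegrableOn (fun x => ∑ i : Fin 3, ‖GW x (EuclideanSpace.single i (1:ℝ))‖ ^ 2) {x : EuclideanSpace ℝ (Fin 3) | ∀ i : Fin 3, |x i| < 1} →
            (∃ ρ' : ℝ, ρ' < ρ ∧ ∀ x : EuclideanSpace ℝ (Fin 3), x ∉ ball y ρ' → W x = U x) →
            ∫ x in ball y ρ, ∑ i : Fin 3, ‖G x (EuclideanSpace.single i (1:ℝ))‖ ^ 2 ≤ ∫ x in ball y ρ, ∑ i : Fin 3, ‖GW x (EuclideanSpace.single i (1:ℝ))‖ ^ 2)) ∧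
        (∀ (y : EuclideanSpace ℝ (Fin 3)) (ρ : ℝ), 0 < ρ → closedBall y ρ ⊆ {x : EuclideanSpace ℝ (Fin 3) | ∀ i : Fin 3, |x i| < 1} →
          Tendsto (fun j : ℕ => ∫ x in ball y ρ, ‖u (φ j) x - U x‖ ^ 2) atTop (𝓝 0)) ∧
        (∀ (y : EuclideanSpace ℝ (Fin 3)) (ρ : ℝ), 0 < ρ → closedBall y ρ ⊆ {x : EuclideanSpace ℝ (Fin 3) | ∀ i : Fin 3, |x i| < 1} →
          Tendsto (fun j : ℕ => ∫ x in ball y ρ, ∑ i : Fin 3, ‖(Gs (φ j)) x (EuclideanSpace.single i (1:ℝ))‖ ^ 2) atTop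
            (𝓝 (∫ x in ball y ρ, ∑ i : Fin 3, ‖G x (EuclideanSpace.single i (1:ℝ))‖ ^ 2)))) :
    ∀ (hQ : IsOpen {x : EuclideanSpace ℝ (Fin 3) | ∀ i : Fin 3, |x i| < 1}) (U : EuclideanSpace ℝ (Fin 3) → EuclideanSpace ℝ (Fin 4)) (G : EuclideanSpace ℝ (Fin 3) → (EuclideanSpace ℝ (Fin 3) →L[ℝ] EuclideanSpace ℝ (Fin 4))),
      (HasWeakFDerivOn ⟨{x : EuclideanSpace ℝ (Fin 3) | ∀ i : Fin 3, |x i| < 1}, hQ⟩ volume U G ∧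
        (∀ x : EuclideanSpace ℝ (Fin 3), (∀ i : Fin 3, |x i| < 1) → ‖U x‖ = 1) ∧
        IntegrableOn (fun x => ∑ i : Fin 3, ‖G x (EuclideanSpace.single i (1:ℝ))‖ ^ 2) {x : EuclideanSpace ℝ (Fin 3) | ∀ i : Fin 3, |x i| < 1} ∧
        (∀ (y : EuclideanSpace ℝ (Fin 3)) (ρ : ℝ), 0 < ρ → closedBall y ρ ⊆ {x : EuclideanSpace ℝ (Fin 3) | ∀ i : Fin 3, |x i| < 1} →
          ∀ (W : EuclideanSpace ℝ (Fin 3) → EuclideanSpace ℝ (Fin 4)) (GW : EuclideanSpace ℝ (Fin 3) → (EuclideanSpace ℝ (Fin 3) →L[ℝ] EuclideanSpace ℝ (Fin 4))),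
          HasWeakFDerivOn ⟨{x : EuclideanSpace ℝ (Fin 3) | ∀ i : Fin 3, |x i| < 1}, hQ⟩ volume W GW →
          (∀ x : EuclideanSpace ℝ (Fin 3), (∀ i : Fin 3, |x i| < 1) → ‖W x‖ = 1) →
          IntegrableOn (fun x => ∑ i : Fin 3, ‖GW x (EuclideanSpace.single i (1:ℝ))‖ ^ 2) {x : EuclideanSpace ℝ (Fin 3) | ∀ i : Fin 3, |x i| < 1} →
          (∃ ρ' : ℝ, ρ' < ρ ∧ ∀ x : EuclideanSpace ℝ (Fin 3), x ∉ ball y ρ' → W x = U x) →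
          ∫ x in ball y ρ, ∑ i : Fin 3, ‖G x (EuclideanSpace.single i (1:ℝ))‖ ^ 2 ≤ ∫ x in ball y ρ, ∑ i : Fin 3, ‖GW x (EuclideanSpace.single i (1:ℝ))‖ ^ 2)) →
      ∃ Θ : ℝ, 0 ≤ Θ ∧
        (∀ r : ℝ, 0 < r → r ≤ 1 / 2 → Θ ≤ r⁻¹ * ∫ x in ball (0 : EuclideanSpace ℝ (Fin 3)) r, ∑ i : Fin 3, ‖G x (EuclideanSpace.single i (1:ℝ))‖ ^ 2) ∧
        (∀ ε : ℝ, 0 < ε → ∃ r₀ : ℝ, 0 < r₀ ∧ r₀ ≤ 1 / 2 ∧ ∀ r : ℝ, 0 < r → r ≤ r₀ →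
          r⁻¹ * ∫ x in ball (0 : EuclideanSpace ℝ (Fin 3)) r, ∑ i : Fin 3, ‖G x (EuclideanSpace.single i (1:ℝ))‖ ^ 2 < Θ + ε) ∧
        ∃ (φ : EuclideanSpace ℝ (Fin 3) → EuclideanSpace ℝ (Fin 4)) (Gφ : EuclideanSpace ℝ (Fin 3) → (EuclideanSpace ℝ (Fin 3) →L[ℝ] EuclideanSpace ℝ (Fin 4))),
      (HasWeakFDerivOn ⟨{x : EuclideanSpace ℝ (Fin 3) | ∀ i : Fin 3, |x i| < 1}, hQ⟩ volume φ Gφ ∧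
        (∀ x : EuclideanSpace ℝ (Fin 3), (∀ i : Fin 3, |x i| < 1) → ‖φ x‖ = 1) ∧
        IntegrableOn (fun x => ∑ i : Fin 3, ‖Gφ x (EuclideanSpace.single i (1:ℝ))‖ ^ 2) {x : EuclideanSpace ℝ (Fin 3) | ∀ i : Fin 3, |x i| < 1} ∧
        (∀ (y : EuclideanSpace ℝ (Fin 3)) (ρ : ℝ), 0 < ρ → closedBall y ρ ⊆ {x : EuclideanSpace ℝ (Fin 3) | ∀ i : Fin 3, |x i| < 1} →
          ∀ (W : EuclideanSpace ℝ (Fin 3) → EuclideanSpace ℝ (Fin 4)) (GW : EuclideanSpace ℝ (Fin 3) → (EuclideanSpace ℝ (Fin 3) →L[ℝ] EuclideanSpace ℝ (Fin 4))),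
          HasWeakFDerivOn ⟨{x : EuclideanSpace ℝ (Fin 3) | ∀ i : Fin 3, |x i| < 1}, hQ⟩ volume W GW →
          (∀ x : EuclideanSpace ℝ (Fin 3), (∀ i : Fin 3, |x i| < 1) → ‖W x‖ = 1) →
          IntegrableOn (fun x => ∑ i : Fin 3, ‖GW x (EuclideanSpace.single i (1:ℝ))‖ ^ 2) {x : EuclideanSpace ℝ (Fin 3) | ∀ i : Fin 3, |x i| < 1} →
          (∃ ρ' : ℝ, ρ' < ρ ∧ ∀ x : EuclideanSpace ℝ (Fin 3), x ∉ ball y ρ' → W x = φ x) →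
          ∫ x in ball y ρ, ∑ i : Fin 3, ‖Gφ x (EuclideanSpace.single i (1:ℝ))‖ ^ 2 ≤ ∫ x in ball y ρ, ∑ i : Fin 3, ‖GW x (EuclideanSpace.single i (1:ℝ))‖ ^ 2)) ∧
          ∀ r : ℝ, 0 < r → r ≤ 1 / 2 → ∫ x in ball (0 : EuclideanSpace ℝ (Fin 3)) r, ∑ i : Fin 3, ‖Gφ x (EuclideanSpace.single i (1:ℝ))‖ ^ 2 = Θ * r := by
  intro hQ U G hS
  have hS' := hS
  obtain ⟨hU, hU1, hGi, hmin⟩ := hS'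
  -- notation-free shorthands
  have hdens0 : ∀ (G' : EuclideanSpace ℝ (Fin 3) → (EuclideanSpace ℝ (Fin 3) →L[ℝ] EuclideanSpace ℝ (Fin 4))) (x : EuclideanSpace ℝ (Fin 3)), 0 ≤ ∑ i : Fin 3, ‖G' x (EuclideanSpace.single i (1:ℝ))‖ ^ 2 :=
    fun G' x => Finset.sum_nonneg fun i _ => by positivity
  have hE0 : ∀ r : ℝ, 0 ≤ ∫ x in ball (0 : EuclideanSpace ℝ (Fin 3)) r, ∑ i : Fin 3, ‖G x (EuclideanSpace.single i (1:ℝ))‖ ^ 2 :=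
    fun r => setIntegral_nonneg measurableSet_ball fun x _ => hdens0 G x
  have hcB : ∀ r : ℝ, r < 1 → closedBall (0 : EuclideanSpace ℝ (Fin 3)) r ⊆ {x : EuclideanSpace ℝ (Fin 3) | ∀ i : Fin 3, |x i| < 1} := fun r hr => closedBall_subset_unitCube hr
  -- the density ratio `f r := r⁻¹ E(B_r(0))` is monotone on `(0, 1/2]`
  have hmono : ∀ σ ρ : ℝ, 0 < σ → σ ≤ ρ → ρ ≤ 1 / 2 →
      σ⁻¹ * ∫ x in ball (0 : EuclideanSpace ℝ (Fin 3)) σ, ∑ i : Fin 3, ‖G x (EuclideanSpace.single i (1:ℝ))‖ ^ 2 ≤ ρ⁻¹ * ∫ x in ball (0 : EuclideanSpace ℝ (Fin 3)) ρ, ∑ i : Fin 3, ‖G x (EuclideanSpace.single i (1:ℝ))‖ ^ 2 :=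
    fun σ ρ hσ hσρ hρ => hMono hQ U G hS 0 σ ρ hσ hσρ (hcB ρ (by linarith))
  -- `Θ := inf` of the density ratio over `(0, 1/2]`
  set S : Set ℝ := (fun r : ℝ => r⁻¹ * ∫ x in ball (0 : EuclideanSpace ℝ (Fin 3)) r, ∑ i : Fin 3, ‖G x (EuclideanSpace.single i (1:ℝ))‖ ^ 2) '' Ioc (0:ℝ) (1 / 2) with hS_def
  have hSne : S.Nonempty := ⟨_, ⟨1 / 2, ⟨by norm_num, le_rfl⟩, rfl⟩⟩
  have hSbdd : BddBelow S := ⟨0, by rintro _ ⟨r, hr, rfl⟩; exact mul_nonneg (inv_nonneg.2 hr.1.le) (hE0 r)⟩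
  set Θ : ℝ := sInf S with hΘ_def
  have hΘle : ∀ r : ℝ, 0 < r → r ≤ 1 / 2 → Θ ≤ r⁻¹ * ∫ x in ball (0 : EuclideanSpace ℝ (Fin 3)) r, ∑ i : Fin 3, ‖G x (EuclideanSpace.single i (1:ℝ))‖ ^ 2 :=
    fun r hr hr2 => csInf_le hSbdd ⟨r, ⟨hr, hr2⟩, rfl⟩
  have hΘ0 : 0 ≤ Θ := le_csInf hSne (by rintro _ ⟨r, hr, rfl⟩; exact mul_nonneg (inv_nonneg.2 hr.1.le) (hE0 r))
  have hΘapprox : ∀ ε : ℝ, 0 < ε → ∃ r₀ : ℝ, 0 < r₀ ∧ r₀ ≤ 1 / 2 ∧ ∀ r : ℝ, 0 < r → r ≤ r₀ →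
      r⁻¹ * ∫ x in ball (0 : EuclideanSpace ℝ (Fin 3)) r, ∑ i : Fin 3, ‖G x (EuclideanSpace.single i (1:ℝ))‖ ^ 2 < Θ + ε := by
    intro ε hε
    obtain ⟨_, ⟨r₀, hr₀, rfl⟩, hlt⟩ := exists_lt_of_csInf_lt hSne (show sInf S < Θ + ε by linarith)
    exact ⟨r₀, hr₀.1, hr₀.2, fun r hr hrr₀ => (hmono r r₀ hr hrr₀ hr₀.2).trans_lt hlt⟩
  -- the blow-up sequence `U_j = U ∘ (t_j•)`, `t_j = 4⁻¹·2⁻ʲ`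
  set t : ℕ → ℝ := fun j => 4⁻¹ * (2⁻¹) ^ j with ht_def
  have ht0 : ∀ j, 0 < t j := fun j => by positivity
  have ht4 : ∀ j, t j ≤ 4⁻¹ := fun j => by
    have : (2⁻¹ : ℝ) ^ j ≤ 1 := pow_le_one₀ (by norm_num) (by norm_num)
    have := mul_le_mul_of_nonneg_left this (by norm_num : (0:ℝ) ≤ 4⁻¹); simpa [ht_def] using this
  have ht1 : ∀ j, t j ≤ 1 := fun j => (ht4 j).trans (by norm_num)
  have htmono : ∀ j k, j ≤ k → t k ≤ t j := fun j k hjk =>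
    mul_le_mul_of_nonneg_left (pow_le_pow_of_le_one (by norm_num) (by norm_num) hjk) (by norm_num)
  have htlim : Tendsto t atTop (𝓝 0) := by
    have := (tendsto_pow_atTop_nhds_zero_of_lt_one (by norm_num : (0:ℝ) ≤ 2⁻¹) (by norm_num)).const_mul (4⁻¹ : ℝ)
    simpa [ht_def] using this
  set u : ℕ → EuclideanSpace ℝ (Fin 3) → EuclideanSpace ℝ (Fin 4) := fun j x => U (t j • x) with hu_def
  set Gs : ℕ → EuclideanSpace ℝ (Fin 3) → (EuclideanSpace ℝ (Fin 3) →L[ℝ] EuclideanSpace ℝ (Fin 4)) := fun j x => t j • G (t j • x) with hGs_def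
  have hSMin : ∀ j : ℕ,
      (HasWeakFDerivOn ⟨{x : EuclideanSpace ℝ (Fin 3) | ∀ i : Fin 3, |x i| < 1}, hQ⟩ volume (u j) (Gs j) ∧
        (∀ x : EuclideanSpace ℝ (Fin 3), (∀ i : Fin 3, |x i| < 1) → ‖(u j) x‖ = 1) ∧
        IntegrableOn (fun x => ∑ i : Fin 3, ‖(Gs j) x (EuclideanSpace.single i (1:ℝ))‖ ^ 2) {x : EuclideanSpace ℝ (Fin 3) | ∀ i : Fin 3, |x i| < 1} ∧
        (∀ (y : EuclideanSpace ℝ (Fin 3)) (ρ : ℝ), 0 < ρ → closedBall y ρ ⊆ {x : EuclideanSpace ℝ (Fin 3) | ∀ i : Fin 3, |x i| < 1} →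
          ∀ (W : EuclideanSpace ℝ (Fin 3) → EuclideanSpace ℝ (Fin 4)) (GW : EuclideanSpace ℝ (Fin 3) → (EuclideanSpace ℝ (Fin 3) →L[ℝ] EuclideanSpace ℝ (Fin 4))),
          HasWeakFDerivOn ⟨{x : EuclideanSpace ℝ (Fin 3) | ∀ i : Fin 3, |x i| < 1}, hQ⟩ volume W GW →
          (∀ x : EuclideanSpace ℝ (Fin 3), (∀ i : Fin 3, |x i| < 1) → ‖W x‖ = 1) →
          IntegrableOn (fun x => ∑ i : Fin 3, ‖GW x (EuclideanSpace.single i (1:ℝ))‖ ^ 2) {x : EuclideanSpace ℝ (Fin 3) | ∀ i : Fin 3, |x i| < 1} →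
          (∃ ρ' : ℝ, ρ' < ρ ∧ ∀ x : EuclideanSpace ℝ (Fin 3), x ∉ ball y ρ' → W x = (u j) x) →
          ∫ x in ball y ρ, ∑ i : Fin 3, ‖(Gs j) x (EuclideanSpace.single i (1:ℝ))‖ ^ 2 ≤ ∫ x in ball y ρ, ∑ i : Fin 3, ‖GW x (EuclideanSpace.single i (1:ℝ))‖ ^ 2)) :=
    fun j => sMin_dilate hQ hS (ht0 j) (ht1 j)
  -- uniform energy bound `E(U_j; Q) ≤ Λ := 2√3·E(U; B_{1/2}) + 1`
  set Λ : ℝ := Real.sqrt 3 * ((1 / 2 : ℝ)⁻¹ * ∫ x in ball (0 : EuclideanSpace ℝ (Fin 3)) (1 / 2), ∑ i : Fin 3, ‖G x (EuclideanSpace.single i (1:ℝ))‖ ^ 2) + 1 with hΛ_def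
  have h3 : (0 : ℝ) < Real.sqrt 3 := Real.sqrt_pos.mpr (by norm_num)
  have h3lt : Real.sqrt 3 < 2 := by
    have h := Real.sq_sqrt (show (0:ℝ) ≤ 3 by norm_num); nlinarith [Real.sqrt_nonneg 3]
  have hEj : ∀ j : ℕ, ∫ x in {x : EuclideanSpace ℝ (Fin 3) | ∀ i : Fin 3, |x i| < 1}, ∑ i : Fin 3, ‖(Gs j) x (EuclideanSpace.single i (1:ℝ))‖ ^ 2 ≤ Λ := by
    intro j
    have h1 : ∫ x in {x : EuclideanSpace ℝ (Fin 3) | ∀ i : Fin 3, |x i| < 1}, ∑ i : Fin 3, ‖(Gs j) x (EuclideanSpace.single i (1:ℝ))‖ ^ 2 = (t j)⁻¹ * ∫ x in {x : EuclideanSpace ℝ (Fin 3) | ∀ i : Fin 3, |x i| < t j}, ∑ i : Fin 3, ‖G x (EuclideanSpace.single i (1:ℝ))‖ ^ 2 :=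
      setIntegral_dens_dilate_unitCube (ht0 j) G
    have hsub : {x : EuclideanSpace ℝ (Fin 3) | ∀ i : Fin 3, |x i| < t j} ⊆ ball (0 : EuclideanSpace ℝ (Fin 3)) (Real.sqrt 3 * t j) := absCube_subset_ball (ht0 j)
    have hσ : Real.sqrt 3 * t j ≤ 1 / 2 := by nlinarith [ht4 j, ht0 j]
    have hballQ : ball (0 : EuclideanSpace ℝ (Fin 3)) (Real.sqrt 3 * t j) ⊆ {x : EuclideanSpace ℝ (Fin 3) | ∀ i : Fin 3, |x i| < 1} := ball_subset_closedBall.trans (hcB _ (by linarith))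
    have h2 : ∫ x in {x : EuclideanSpace ℝ (Fin 3) | ∀ i : Fin 3, |x i| < t j}, ∑ i : Fin 3, ‖G x (EuclideanSpace.single i (1:ℝ))‖ ^ 2 ≤ ∫ x in ball (0 : EuclideanSpace ℝ (Fin 3)) (Real.sqrt 3 * t j), ∑ i : Fin 3, ‖G x (EuclideanSpace.single i (1:ℝ))‖ ^ 2 :=
      setIntegral_mono_set (hGi.mono_set hballQ) (Eventually.of_forall fun x => hdens0 G x) (Eventually.of_forall hsub)
    have hm := hmono (Real.sqrt 3 * t j) (1 / 2) (by positivity) hσ le_rfl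
    have hpos : 0 < Real.sqrt 3 * t j := by positivity
    rw [h1]
    calc (t j)⁻¹ * ∫ x in {x : EuclideanSpace ℝ (Fin 3) | ∀ i : Fin 3, |x i| < t j}, ∑ i : Fin 3, ‖G x (EuclideanSpace.single i (1:ℝ))‖ ^ 2
        ≤ (t j)⁻¹ * ∫ x in ball (0 : EuclideanSpace ℝ (Fin 3)) (Real.sqrt 3 * t j), ∑ i : Fin 3, ‖G x (EuclideanSpace.single i (1:ℝ))‖ ^ 2 := mul_le_mul_of_nonneg_left h2 (inv_nonneg.2 (ht0 j).le)
      _ = Real.sqrt 3 * ((Real.sqrt 3 * t j)⁻¹ * ∫ x in ball (0 : EuclideanSpace ℝ (Fin 3)) (Real.sqrt 3 * t j), ∑ i : Fin 3, ‖G x (EuclideanSpace.single i (1:ℝ))‖ ^ 2) := by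
          have htj : t j ≠ 0 := (ht0 j).ne'
          have h3' : Real.sqrt 3 ≠ 0 := h3.ne'
          field_simp
      _ ≤ Real.sqrt 3 * ((1 / 2 : ℝ)⁻¹ * ∫ x in ball (0 : EuclideanSpace ℝ (Fin 3)) (1 / 2), ∑ i : Fin 3, ‖G x (EuclideanSpace.single i (1:ℝ))‖ ^ 2) := mul_le_mul_of_nonneg_left hm h3.le
      _ ≤ Λ := by rw [hΛ_def]; linarith
  -- (C): a class member `φ` with convergent ball energies along `ψ`
  obtain ⟨φ, Gφ, ψ, hψ, hSφ, -, hEn⟩ := hCpt hQ Λ u Gs hSMin hEj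
  obtain ⟨hφ, hφ1, hGφi, hφmin⟩ := hSφ
  -- ball energies of `U_j`
  have hEuj : ∀ (j : ℕ) (r : ℝ), ∫ x in ball (0 : EuclideanSpace ℝ (Fin 3)) r, ∑ i : Fin 3, ‖(Gs j) x (EuclideanSpace.single i (1:ℝ))‖ ^ 2 = (t j)⁻¹ * ∫ x in ball (0 : EuclideanSpace ℝ (Fin 3)) (t j * r), ∑ i : Fin 3, ‖G x (EuclideanSpace.single i (1:ℝ))‖ ^ 2 := by
    intro j r
    have := setIntegral_dens_dilate_ball (ht0 j) G 0 r
    rwa [smul_zero] at this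
  -- `E(φ; B_r(0)) = Θ·r` for `0 < r ≤ 1/2`
  have hElin : ∀ r : ℝ, 0 < r → r ≤ 1 / 2 → ∫ x in ball (0 : EuclideanSpace ℝ (Fin 3)) r, ∑ i : Fin 3, ‖Gφ x (EuclideanSpace.single i (1:ℝ))‖ ^ 2 = Θ * r := by
    intro r hr hr2
    have hconv := hEn 0 r hr (hcB r (by linarith))
    have hconv' : Tendsto (fun j : ℕ => ∫ x in ball (0 : EuclideanSpace ℝ (Fin 3)) r, ∑ i : Fin 3, ‖(Gs (ψ j)) x (EuclideanSpace.single i (1:ℝ))‖ ^ 2) atTop (𝓝 (Θ * r)) := by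
      rw [Metric.tendsto_atTop]
      intro ε hε
      obtain ⟨r₀, hr₀, hr₀2, hlt⟩ := hΘapprox (ε / (2 * r)) (by positivity)
      obtain ⟨N, hN⟩ := (Metric.tendsto_atTop.1 htlim) (r₀ / r) (by positivity)
      refine ⟨N, fun j hj => ?_⟩
      have hψj : N ≤ ψ j := hj.trans (hψ.id_le j)
      have htj : t (ψ j) < r₀ / r := by
        have := hN (ψ j) hψj; rw [Real.dist_eq, sub_zero, abs_of_pos (ht0 _)] at this; exact this
      have hs0 : 0 < t (ψ j) * r := mul_pos (ht0 _) hr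
      have hsr₀ : t (ψ j) * r ≤ r₀ := by rw [lt_div_iff₀ hr] at htj; exact htj.le
      have hup := hlt (t (ψ j) * r) hs0 hsr₀
      have hlow := hΘle (t (ψ j) * r) hs0 (hsr₀.trans hr₀2)
      rw [hEuj, Real.dist_eq]
      set I : ℝ := ∫ x in ball (0 : EuclideanSpace ℝ (Fin 3)) (t (ψ j) * r), ∑ i : Fin 3, ‖G x (EuclideanSpace.single i (1:ℝ))‖ ^ 2 with hI_def
      set s : ℝ := t (ψ j) with hs_def
      have hsne : s ≠ 0 := (ht0 (ψ j)).ne'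
      have hrne : r ≠ 0 := hr.ne'
      have hid : s⁻¹ * I - Θ * r = r * ((s * r)⁻¹ * I - Θ) := by
        field_simp
      rw [hid, abs_mul, abs_of_pos hr]
      have hb : |(s * r)⁻¹ * I - Θ| < ε / (2 * r) := by
        rw [abs_lt]; constructor <;> linarith
      calc r * |(s * r)⁻¹ * I - Θ| < r * (ε / (2 * r)) := mul_lt_mul_of_pos_left hb hr
        _ = ε / 2 := by field_simp
        _ < ε := by linarith
    exact tendsto_nhds_unique hconv hconv'
  exact ⟨Θ, hΘ0, hΘle, hΘapprox, φ, Gφ, ⟨hφ, hφ1, hGφi, hφmin⟩, hElin⟩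

end Summit.QuantumFields.YangMills.Theorems.PoincareLipschitzCentralDensityCap

end
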